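import Literature.MathematicalPhysics.QuantumFieldTheory.Balaban1983to89.Beta.InterLevelTransport
import Summits.QuantumFields.BalabanUV.Beta.D1BFx.DressedTadpoleTable
import Summits.QuantumFields.BalabanUV.Beta.FP.ResponseVertexLipschitz

/-!
# `BalabanUV.Beta.FP.KernelStepDressing` — road «FP», binder row D1, ROUTE T (β1), (H5-F) proper, FILE 1: **THE KERNEL-LEVEL STEP DRESSING OF
# VERTEX FAMILIES** — a first-order family `V c t` and a second-order family `W c t e t′`, indexed by the bonds of a lattice of blocking `N`
# and bi-localised at their own coarse points, are read one blocking `L` coarser through an entry kernel `w : EKer (d+1)` (the step's response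
# column): `dressV N L w V μ z := Σ_c Σ'_t w c μ (L•z − t) • V c t`, `dressW N L w W μ z ν z′ := Σ_{c,e} Σ'_{t,t′} w c μ (L•z − t) · w e ν (L•z′ − t′) •
# W c t e t′` (the lattice sums realised as an4's coarse-indexed superpositions `InterLevelTransport.cwsum N`); their LOCALISATION at blocking `N·L`
# (`VertexFamily ∕ VertexFamily₂` transported) and their block COVARIANCE.  FILE 2 (`KernelStepDressingHessKer`) proves the identity of v10's `htr`
# shape: `hessKer A (dressV …) (dressW …) μ ν z = dressedEntry w (hessKer A V W) (L•z) μ ν`.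

WHY (located).  v10 `FP/StepRecursionFeedNestedNamedI` (twin 95207dc80dde0fe8) displays (S3-2 F) the F-system's vertex families `𝒱F 𝒲F` as FREE data with
thirteen letters and (H6) the transport row `htr : hessKer (AF (j+1)) (𝒱F (j+1)) (𝒲F (j+1)) μ ν z = Lc⁸ · dressedEntry (wStep Lc (j+1)) (hessKer (AN j) (VN j) (WN j)) (Lc•z) μ ν`;
an2 g79 J-NOTE-23 proper §3 (H5-F): «what the tree LACKS is the kernel-level dressing `K ↦ K^{dressed}` … and the transport of `Decays ∕ VertexFamily ∕ parities ∕
KKT` through it»; road g58 A-2 l.68977 (c): the F-system at storey `n+1` is the N-system at storey `n` on the finer box, so only the FAMILIES need dressing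
(`𝒱F (j+1) := Lc⁴ • dressV … (VN j)`, `𝒲F (j+1) := Lc⁸ • dressW … (WN j)` up to the σ-units), the chart does not.  This file supplies the objects and their
two analytic letters; nothing of v10 is touched.

WHAT ([folklore] lattice-sum bookkeeping over OUR typed objects; two definitions with bodies ([our object — bookkeeping] `dressV`, `dressW`); nothing cited, 0 sorry).
* §1 `dressV`, `dressW`, unfoldings `dressV_apply ∕ dressW_apply` (the plain `Σ'` forms, `cwsum_apply`).
* §2 weight letters: a column entry `u ↦ w c a u` decaying from `0` at rate `δ`, read at `L•z − t`, decays from the fine point `N•(L•z)` at rate `δ∕N` as a function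
  of the coarse point `N•t` (`abs_colWeight_le`); extension-by-zero letters with ONE running centre (`biLoc_onLat_snd ∕ _fst`; the diagonal and weight twins are the
  road's `FP/ResponseVertexLipschitz.biLoc_onLat_self` and `FP/MixVertexLimit.abs_onLat_le`, re-used by name — chair leaf-03 g66 C-4 DOCFIX-1).
* §3 **`vertexFamily_dressV`**, **`vertexFamily₂_dressW`**: `VertexFamily V N Cv δ` ⟹ `VertexFamily (dressV N L w V) (N·L) C′ δ′` (an4 `biLoc_cwsum` + `biLoc_finset_sum`);
  the second-order twin through leaf-01's moving-centre superposition letters `DressedTadpoleTable.biLoc_wsum_fst ∕ _snd`.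
* §4 **`dressV_translate`**, **`dressW_translate`**: block covariance at blocking `N·L` from covariance of `V ∕ W` at blocking `N` (an4 `cwsum_translate`).
WHAT THIS IS NOT: not the `hessKer` identity (FILE 2); not the parities ∕ winding ∕ door-jet letters of (S3-2 F) (periodisation side, the box-level twin); not an
instantiation at `VN WN wStep` (the END's choice); nothing of Bałaban's asserted, valued or discharged; 0 estimates; 0∕4 row-D1 binders (hW ∕ hR ∕ D1Tel ∕ D1Rep);
NOT (C1), NOT D1, NEVER «G-an2-4 closed», NOT BetaPertH, NOT continuum, NOT Clay.
HONEST DEPENDENCY (page 1, mandatory): continuum YM on T⁴ ⇐ BetaPertH ∧ nine spine estimates (0/9 proved); BetaPertH ⇐ (D1) ∧ (D4) ∧ CAP+tail;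
G-an2-4 gates asym, D1 and NE2/3/4.  HONEST FRAMING (cell contract, verbatim): «discharging `BetaPertH` makes Bałaban's UV stability UNCONDITIONAL —
a real constructive-QFT result; it is NOT the continuum limit and NOT the Clay problem.»  ABSOLUTE RULE (cell charter, verbatim): «No internally-minted
statement may enter as a cited fact. Every hypothesis is either kernel-proved in this package or a verbatim quotation of a PUBLISHED theorem with page
reference. The manuscript(s) under audit are NOT citable for their own disputed steps — they are the thing under adjudication; programme-internal
(2001/route/tribunal) claims are never citable.»  Road «FP» OWNER, b2b-balaban-beta-d1-p3 gen 58, 2026-08-29.  No existing file touched.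
-/

noncomputable section

open scoped BigOperators

namespace Summit.QuantumFields.BalabanUV.Beta.FP.KernelStepDressing

open Finset
open Literature.Probability.LatticeModels (Torus.proj)
open Literature.MathematicalPhysics.QuantumFieldTheory
open Literature.MathematicalPhysics.QuantumFieldTheory.Balaban1983to89
open Literature.MathematicalPhysics.QuantumFieldTheory.Balaban1983to89.Beta
open B12Sec2to5 (l1 l1_nonneg)
open ExpKernelCalculus (Site MKer BiLoc VertexFamily VertexFamily₂ shiftK Zl Zl_nonneg l1_natSmul l1_sub_symm)
open LatticeForm (quo)
open DressedMomentNormalisation (EKer)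
open OneStepResolventKernel (Fib wsum biLoc_finset_sum eq_zsmul_quo_of_proj quo_zsmul)
open InterLevelTransport (onLat onLat_zsmul onLat_off cwsum cwsum_apply biLoc_cwsum cwsum_translate)
open Summit.QuantumFields.BalabanUV.Beta.TameKernelCalculus (biLoc_of_le)
open Summit.QuantumFields.BalabanUV.Beta.D1BFx.DressedTadpoleTable (biLoc_wsum_fst biLoc_wsum_snd)
open Summit.QuantumFields.BalabanUV.Beta.FP.MixVertexLimit (abs_onLat_le)
open Summit.QuantumFields.BalabanUV.Beta.FP.ResponseVertexLipschitz (biLoc_onLat_self)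

variable {d : ℕ}

/-! ## §1 The dressed families -/

section Defs

variable (N L : ℕ) (w : EKer (d + 1)) (V : Fin (d + 1) → Site (d + 1) → MKer (d + 1) (Fib d))
  (W : Fin (d + 1) → Site (d + 1) → Fin (d + 1) → Site (d + 1) → MKer (d + 1) (Fib d))

/-- [our object — bookkeeping] **THE STEP-DRESSED FIRST-ORDER FAMILY**: `dressV N L w V μ z := Σ_c Σ'_t w c μ (L•z − t) • V c t` — the family `V`
(indexed by the bonds `(c, t)` of a lattice of blocking `N`) read at the bond `(μ, z)` of the lattice of blocking `N·L` through the entry kernel `w`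
(the response column of one step of blocking `L`); the lattice sum is an4's `cwsum N`. -/
def dressV (μ : Fin (d + 1)) (z : Site (d + 1)) : MKer (d + 1) (Fib d) :=
  fun x y a b => ∑ c : Fin (d + 1), cwsum N (fun t => w c μ ((L : ℤ) • z - t)) (V c) x y a b

/-- [our object — bookkeeping] **THE STEP-DRESSED SECOND-ORDER FAMILY**: `dressW N L w W μ z ν z′ := Σ_{c,e} Σ'_t Σ'_{t′} w c μ (L•z − t) · w e ν (L•z′ − t′) •
W c t e t′`. -/
def dressW (μ : Fin (d + 1)) (z : Site (d + 1)) (ν : Fin (d + 1)) (z' : Site (d + 1)) : MKer (d + 1) (Fib d) :=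
  fun x y a b => ∑ c : Fin (d + 1), ∑ e : Fin (d + 1),
    cwsum N (fun t => w c μ ((L : ℤ) • z - t)) (fun t => cwsum N (fun t' => w e ν ((L : ℤ) • z' - t')) (W c t e)) x y a b

variable [NeZero N]

/-- [folklore] unfolding of `dressV` as a plain lattice sum. -/
theorem dressV_apply (μ : Fin (d + 1)) (z x y : Site (d + 1)) (a b : Fib d) :
    dressV N L w V μ z x y a b = ∑ c : Fin (d + 1), ∑' t : Site (d + 1), w c μ ((L : ℤ) • z - t) * V c t x y a b := by
  simp only [dressV, cwsum_apply]

/-- [folklore] unfolding of `dressW` as a plain double lattice sum. -/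
theorem dressW_apply (μ : Fin (d + 1)) (z : Site (d + 1)) (ν : Fin (d + 1)) (z' x y : Site (d + 1)) (a b : Fib d) :
    dressW N L w W μ z ν z' x y a b
      = ∑ c : Fin (d + 1), ∑ e : Fin (d + 1), ∑' t : Site (d + 1), w c μ ((L : ℤ) • z - t)
          * ∑' t' : Site (d + 1), w e ν ((L : ℤ) • z' - t') * W c t e t' x y a b := by
  simp only [dressW, cwsum_apply]

end Defs

/-! ## §2 Letters of the weights and of the extensions by zero -/

section Weights

variable {N : ℕ} [NeZero N]

/-- [folklore] `N • (L • z)` is `(N·L) • z`. -/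
theorem smul_smul_natCast (N L : ℕ) (z : Site (d + 1)) : (N : ℤ) • ((L : ℤ) • z) = ((N * L : ℕ) : ℤ) • z := by
  rw [smul_smul, Nat.cast_mul]

/-- [folklore] **THE SHIFTED COLUMN WEIGHT DECAYS FROM `N•(L•z)` IN FINE UNITS**: `|w c a u| ≤ C e^{−δ|u|₁}` for all `u` ⟹
`|w c a (L•z − t)| ≤ C e^{−(δ∕N)|N•t − N•(L•z)|₁}`. -/
theorem abs_colWeight_le {w : EKer (d + 1)} {C δ : ℝ} (hw : ∀ c a u, |w c a u| ≤ C * Real.exp (-δ * l1 u)) (L : ℕ) (c a : Fin (d + 1))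
    (z t : Site (d + 1)) :
    |w c a ((L : ℤ) • z - t)| ≤ C * Real.exp (-(δ / N) * l1 ((N : ℤ) • t - (N : ℤ) • ((L : ℤ) • z))) := by
  have hN : (N : ℝ) ≠ 0 := by exact_mod_cast (NeZero.ne N)
  have h1 : l1 ((N : ℤ) • t - (N : ℤ) • ((L : ℤ) • z)) = (N : ℝ) * l1 (((L : ℤ) • z) - t) := by
    rw [← smul_sub, l1_natSmul, l1_sub_symm]
  rw [h1, show -(δ / N) * ((N : ℝ) * l1 ((L : ℤ) • z - t)) = -δ * l1 ((L : ℤ) • z - t) by field_simp]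
  exact hw c a _

/-- [folklore] **EXTENSION BY ZERO WITH A FIXED FIRST CENTRE**: a coarse-indexed family `K t′` bi-localised at `(q, N•t′)`, extended by zero off `N•ℤ^{d+1}`,
is bi-localised at `(q, u)` at its fine index `u`. -/
theorem biLoc_onLat_snd {F : Type*} {K : Site (d + 1) → MKer (d + 1) F} {q : Site (d + 1)} {C δ : ℝ} (hC : 0 ≤ C)
    (hK : ∀ t', BiLoc (K t') q ((N : ℤ) • t') C δ) (u : Site (d + 1)) : BiLoc (onLat N K u) q u C δ := by
  by_cases hu : Torus.proj N u = 0
  · have e := eq_zsmul_quo_of_proj (N := N) hu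
    simp only [onLat, hu, if_true]
    have h := hK (quo N u)
    rwa [← e] at h
  · intro x y a b
    rw [onLat_off K hu]
    show |(0 : ℝ)| ≤ _
    rw [abs_zero]
    positivity

/-- [folklore] **EXTENSION BY ZERO WITH A FIXED SECOND CENTRE** (mirror of `biLoc_onLat_snd`). -/
theorem biLoc_onLat_fst {F : Type*} {K : Site (d + 1) → MKer (d + 1) F} {q : Site (d + 1)} {C δ : ℝ} (hC : 0 ≤ C)
    (hK : ∀ t, BiLoc (K t) ((N : ℤ) • t) q C δ) (u : Site (d + 1)) : BiLoc (onLat N K u) u q C δ := by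
  by_cases hu : Torus.proj N u = 0
  · have e := eq_zsmul_quo_of_proj (N := N) hu
    simp only [onLat, hu, if_true]
    have h := hK (quo N u)
    rwa [← e] at h
  · intro x y a b
    rw [onLat_off K hu]
    show |(0 : ℝ)| ≤ _
    rw [abs_zero]
    positivity

end Weights

/-! ## §3 Localisation: the dressed families are vertex families at blocking `N·L` -/

section Loc

variable {N : ℕ} [NeZero N] (L : ℕ) {w : EKer (d + 1)} {Cw δw : ℝ}
  {V : Fin (d + 1) → Site (d + 1) → MKer (d + 1) (Fib d)} {Cv δ : ℝ}
  {W : Fin (d + 1) → Site (d + 1) → Fin (d + 1) → Site (d + 1) → MKer (d + 1) (Fib d)} {C2 : ℝ}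

/-- [folklore] **`dressV` IS A VERTEX FAMILY AT BLOCKING `N·L`**: each summand `cwsum N (w c μ (L•z − ·)) (V c)` is bi-localised at `(N·L)•z` by an4's
`biLoc_cwsum` (weights at rate `min (δw∕N) δ` from `N•(L•z)`, members at their own coarse points), and the `d+1` summands add (`biLoc_finset_sum`). -/
theorem vertexFamily_dressV (hw : ∀ c a u, |w c a u| ≤ Cw * Real.exp (-δw * l1 u)) (hCw : 0 ≤ Cw) (hδw : 0 < δw)
    (hV : VertexFamily V N Cv δ) (hδ : 0 < δ) :
    VertexFamily (dressV N L w V) (N * L)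
      (∑ _c : Fin (d + 1), Cw * |Cv| * Zl (d + 1) (min (δw / N) δ / 2)) (min (δw / N) δ / 2) := by
  intro μ z
  have hNpos : (0 : ℝ) < N := by exact_mod_cast Nat.pos_of_ne_zero (NeZero.ne N)
  have hm : 0 < min (δw / N) δ := lt_min (div_pos hδw hNpos) hδ
  have hsum : ∀ c ∈ (Finset.univ : Finset (Fin (d + 1))),
      BiLoc (cwsum N (fun t => w c μ ((L : ℤ) • z - t)) (V c)) (((N * L : ℕ) : ℤ) • z) (((N * L : ℕ) : ℤ) • z)
        (Cw * |Cv| * Zl (d + 1) (min (δw / N) δ / 2)) (min (δw / N) δ / 2) := by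
    intro c _
    rw [← smul_smul_natCast]
    refine biLoc_cwsum (fun t => ?_) (fun t => biLoc_of_le (hV c t) (min_le_right _ _)) hm hCw
    refine (abs_colWeight_le (N := N) hw L c μ z t).trans (mul_le_mul_of_nonneg_left (Real.exp_le_exp.2 ?_) hCw)
    nlinarith [l1_nonneg ((N : ℤ) • t - (N : ℤ) • ((L : ℤ) • z)), min_le_left (δw / N) δ]
  exact biLoc_finset_sum Finset.univ hsum

/-- [folklore] **`dressW` IS A SECOND-ORDER VERTEX FAMILY AT BLOCKING `N·L`**: the inner superposition over `t′` is bi-localised at `(N•t, (N·L)•z′)`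
(`biLoc_wsum_snd` on the extensions by zero), uniformly in `t`; the outer one over `t` then at `((N·L)•z, (N·L)•z′)` (`biLoc_wsum_fst`); the `(d+1)²`
summands add. -/
theorem vertexFamily₂_dressW (hw : ∀ c a u, |w c a u| ≤ Cw * Real.exp (-δw * l1 u)) (hCw : 0 ≤ Cw) (hδw : 0 < δw)
    (hW : VertexFamily₂ W N C2 δ) (hδ : 0 < δ) :
    VertexFamily₂ (dressW N L w W) (N * L)
      (∑ _c : Fin (d + 1), ∑ _e : Fin (d + 1),
        Cw * (Cw * |C2| * Zl (d + 1) (min (δw / N) δ / 2)) * Zl (d + 1) (min (δw / N) δ / 2 / 2)) (min (δw / N) δ / 2 / 2) := by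
  intro μ z ν z'
  have hNpos : (0 : ℝ) < N := by exact_mod_cast Nat.pos_of_ne_zero (NeZero.ne N)
  set m : ℝ := min (δw / N) δ with hm_def
  have hm : 0 < m := lt_min (div_pos hδw hNpos) hδ
  have hC2 : 0 ≤ |C2| := abs_nonneg _
  -- the lifted weights, both decaying at rate `m` from `N•(L•z)` resp. `N•(L•z′)`
  have hwt : ∀ (c a : Fin (d + 1)) (zz : Site (d + 1)) (u : Site (d + 1)),
      |onLat N (fun t => w c a ((L : ℤ) • zz - t)) u| ≤ Cw * Real.exp (-m * l1 (u - (N : ℤ) • ((L : ℤ) • zz))) := by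
    intro c a zz u
    refine abs_onLat_le (N := N) (fun t => ?_) u
    refine (abs_colWeight_le (N := N) hw L c a zz t).trans (mul_le_mul_of_nonneg_left (Real.exp_le_exp.2 ?_) hCw)
    nlinarith [l1_nonneg ((N : ℤ) • t - (N : ℤ) • ((L : ℤ) • zz)), min_le_left (δw / N) δ]
  have hsum : ∀ c ∈ (Finset.univ : Finset (Fin (d + 1))), BiLoc (fun x y a b => ∑ e : Fin (d + 1),
      cwsum N (fun t => w c μ ((L : ℤ) • z - t)) (fun t => cwsum N (fun t' => w e ν ((L : ℤ) • z' - t')) (W c t e)) x y a b)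
      (((N * L : ℕ) : ℤ) • z) (((N * L : ℕ) : ℤ) • z')
      (∑ _e : Fin (d + 1), Cw * (Cw * |C2| * Zl (d + 1) (m / 2)) * Zl (d + 1) (m / 2 / 2)) (m / 2 / 2) := by
    intro c _
    refine biLoc_finset_sum Finset.univ fun e _ => ?_
    rw [← smul_smul_natCast, ← smul_smul_natCast]
    -- inner: for each `t`, the superposition over `t′` is bi-localised at `(N•t, N•(L•z′))`
    have hin : ∀ t : Site (d + 1), BiLoc (cwsum N (fun t' => w e ν ((L : ℤ) • z' - t')) (W c t e)) ((N : ℤ) • t)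
        ((N : ℤ) • ((L : ℤ) • z')) (Cw * |C2| * Zl (d + 1) (m / 2)) (m / 2) := by
      intro t
      unfold InterLevelTransport.cwsum
      exact biLoc_wsum_snd (hwt e ν z') (fun u' => biLoc_onLat_snd (N := N) hC2
        (fun t' => biLoc_of_le (hW c t e t') (min_le_right _ _)) u') hm hCw
    -- outer: lift in `t` and superpose with the weight decaying from `N•(L•z)`
    unfold InterLevelTransport.cwsum
    have hCin : 0 ≤ Cw * |C2| * Zl (d + 1) (m / 2) := mul_nonneg (mul_nonneg hCw hC2) (Zl_nonneg (by linarith))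
    have hfam : ∀ u, BiLoc (onLat N (fun t => wsum (onLat N (fun t' => w e ν ((L : ℤ) • z' - t'))) (onLat N (W c t e))) u) u
        ((N : ℤ) • ((L : ℤ) • z')) (Cw * |C2| * Zl (d + 1) (m / 2)) (m / 2) :=
      fun u => biLoc_onLat_fst (N := N) hCin hin u
    exact biLoc_wsum_fst (fun u => (hwt c μ z u).trans (mul_le_mul_of_nonneg_left (Real.exp_le_exp.2 (by
      nlinarith [l1_nonneg (u - (N : ℤ) • ((L : ℤ) • z))])) hCw)) hfam (half_pos hm) hCw
  exact biLoc_finset_sum Finset.univ hsum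

end Loc

/-! ## §4 Block covariance at blocking `N·L` -/

section Cov

variable {N : ℕ} [NeZero N] (L : ℕ) (w : EKer (d + 1))
  {V : Fin (d + 1) → Site (d + 1) → MKer (d + 1) (Fib d)}
  {W : Fin (d + 1) → Site (d + 1) → Fin (d + 1) → Site (d + 1) → MKer (d + 1) (Fib d)}

/-- [folklore] **`dressV` IS `(N·L)`-BLOCK COVARIANT** when `V` is `N`-block covariant: `dressV … μ (z + s) = shiftK (−((N·L)•s)) (dressV … μ z)`
(re-index `t ↦ t − L•s`, an4 `cwsum_translate`). -/
theorem dressV_translate (hV : ∀ (c : Fin (d + 1)) (t s : Site (d + 1)), V c (t + s) = shiftK (-((N : ℤ) • s)) (V c t))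
    (μ : Fin (d + 1)) (z s : Site (d + 1)) :
    dressV N L w V μ (z + s) = shiftK (-(((N * L : ℕ) : ℤ) • s)) (dressV N L w V μ z) := by
  funext x y a b
  simp only [dressV, shiftK, ← smul_smul_natCast]
  refine Finset.sum_congr rfl fun c _ => ?_
  have hfun : (fun t => w c μ ((L : ℤ) • (z + s) - t)) = fun t => (fun t₀ => w c μ ((L : ℤ) • z - t₀)) (t - (L : ℤ) • s) := by
    funext t; congr 1; rw [smul_add]; abel
  have h := cwsum_translate (N := N) (fun t₀ => w c μ ((L : ℤ) • z - t₀)) ((L : ℤ) • s) (Q := V c) (fun t => hV c t ((L : ℤ) • s))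
  rw [hfun, h, smul_smul]
  rfl

/-- [folklore] **`dressW` IS `(N·L)`-BLOCK COVARIANT** (both arguments shifted by `s`) when `W` is jointly `N`-block covariant (re-index both lattice sums by
`L•s`). -/
theorem dressW_translate
    (hW : ∀ (c : Fin (d + 1)) (t : Site (d + 1)) (e : Fin (d + 1)) (t' s : Site (d + 1)),
      W c (t + s) e (t' + s) = shiftK (-((N : ℤ) • s)) (W c t e t'))
    (μ : Fin (d + 1)) (z : Site (d + 1)) (ν : Fin (d + 1)) (z' s : Site (d + 1)) :
    dressW N L w W μ (z + s) ν (z' + s) = shiftK (-(((N * L : ℕ) : ℤ) • s)) (dressW N L w W μ z ν z') := by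
  funext x y a b
  show _ = dressW N L w W μ z ν z' (x + -(((N * L : ℕ) : ℤ) • s)) (y + -(((N * L : ℕ) : ℤ) • s)) a b
  rw [dressW_apply, dressW_apply]
  refine Finset.sum_congr rfl fun c _ => Finset.sum_congr rfl fun e _ => ?_
  have inner : ∀ t : Site (d + 1),
      (∑' t' : Site (d + 1), w e ν ((L : ℤ) • (z' + s) - t') * W c (t + (L : ℤ) • s) e t' x y a b)
        = ∑' t' : Site (d + 1), w e ν ((L : ℤ) • z' - t')
            * W c t e t' (x + -(((N * L : ℕ) : ℤ) • s)) (y + -(((N * L : ℕ) : ℤ) • s)) a b := by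
    intro t
    rw [← (Equiv.addRight ((L : ℤ) • s)).tsum_eq]
    refine tsum_congr fun t' => ?_
    simp only [Equiv.coe_addRight]
    rw [hW c t e t' ((L : ℤ) • s), smul_smul_natCast]
    show w e ν ((L : ℤ) • (z' + s) - (t' + (L : ℤ) • s)) * W c t e t' (x + -(((N * L : ℕ) : ℤ) • s)) (y + -(((N * L : ℕ) : ℤ) • s)) a b = _
    congr 2
    rw [smul_add]; abel
  rw [← (Equiv.addRight ((L : ℤ) • s)).tsum_eq]
  refine tsum_congr fun t => ?_
  simp only [Equiv.coe_addRight]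
  rw [inner t]
  congr 2
  rw [smul_add]; abel

end Cov

end Summit.QuantumFields.BalabanUV.Beta.FP.KernelStepDressing

end
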